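import Summits.BirchSwinnertonDyer.BirchSwinnertonDyer.Theorems.ManinLocalTwoThreeManinPrimeToAdditiveFiveLeCornersOfStrongIsUnstarred
import Summits.BirchSwinnertonDyer.BirchSwinnertonDyer.Theorems.ManinLocalTwoThreeManinPrimeToAdditiveFiveLeLedgerByNameOfKato
import Summits.BirchSwinnertonDyer.BirchSwinnertonDyer.Theorems.ManinLocalTwoThreeManinPrimeToAdditiveFiveLeRED13OfTwistedLatticeItems
import HarnessLib

/-!
# Route `ManinLocalTwoThree`, residual crux C5 `ManinPrimeToAdditiveFiveLe`
# (stmt-BirchSwinnertonDyer-22969), line `upper_anchor` (skeleton v11 → v12, registered stub `stub_acrossIsogeny57`):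
# **K15a `SupersingularStrongIsUnstarred` (stmt-27072) is WEAKER than E-imc-5(5) ∧ E-imc-5(7) ∧ Gealy–Klagsbrun, and
# C5 BY NAME needs only SIX prints ∧ stmt-27071 ∧ stmt-27552 ∧ stmt-27072 ∧ E-imc-9(13)**

Width seat bsd-line-ml23-c5-p1-w2 (gen 5), piece ψ, part 2/2 (part 1/2: `…CornersOfStrongIsUnstarred.lean` — CORNER(5; II)
and the starred reducible residue at `5, 7` from K15a ∧ K15b ∧ stmt-27552, with no orientation law (U)).

* §1 `supersingularStrongIsUnstarred_of_acrossIsogeny_of_gealyKlagsbrun` — **K15a BY NAME ⟸ modularity ∧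
  Gealy–Klagsbrun 2017 Thm. 1 ∧ E-imc-5 `OptimalUnstarredAcrossIsogeny` at `5` and `7`** (the width seat's kernel υ
  `padicValInt_le_four_of_acrossIsogeny_of_gealyKlagsbrun`, p626338, on K15a's starred rows `(5;8)`, `(7;9)`: additive by
  level = conductor, potentially good because `W ⊗ p*` is not multiplicative, no `Iₙ*`, tame index `3 ∤ 4`, `4 ∤ 6` so not
  (G)-ordinary). Hence re-socketing the line's stub `stub_acrossIsogeny57` (E-imc-5(5) ∧ E-imc-5(7)) onto K15a is a
  WEAKENING of hypotheses, and Gealy–Klagsbrun (conjunct 8 of v11's `stub_printedInputs`) becomes idle.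
* §2 `coreRED57sharp_of_cns_of_twistFamilyItems` — **RED(57♯) (hypothesis `h57s` of p612504, VERBATIM) ⟸ ČNS ∧ K15b
  (stmt-27071) ∧ `OrdinaryCornerManinResidual` (stmt-27552) ∧ K15a (stmt-27072)**: the lead's split
  `coreRED57sharp_of_unstarred_of_starred` (p630701) fed with the flip-twin reduction p622240 over the three Raynaud cells
  (p625709 from 27071/27552, plumbing of p628635) and part 1's `cornerTypeIIAtFive_of_strongIsUnstarred`, and with part 1's
  `coreRED57starred_of_twistFamilyItems`.
* §3 `maninPrimeToAdditiveFiveLe_of_sixPrints_of_twistFamilyItems_of_ordinaryTwistLaw` — **C5 BY NAME ⟸ F″ ∧ ČNS ∧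
  Cremona ≤ 5·10⁵ ∧ EdK ∧ EdG ∧ MazurJ ∧ stmt-27071 ∧ stmt-27552 ∧ stmt-27072 ∧ `OrdinaryRamifiedTwistLaw 13`** — the
  lead's `maninPrimeToAdditiveFiveLe_of_sevenPrints_of_twistFamilyItems_of_imcLaws` (`…LedgerByNameOfKato.lean`) with
  {GK, E-imc-5(5), E-imc-5(7)} ↦ {K15a}: `W[p]`-irreducible locus from modularity ∧ F″ (`coreKP_of_kato`, lead, via
  pub/bsd-wall's `TeichmullerTwistDescent.not_dvd_c_of_kato`), reducible residual via p608852 over §2 and the RED(13♯)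
  chain (p612408 ∘ p614544 ∘ p626766).

* §4 `maninPrimeToAdditiveFiveLe_of_sevenPrints_of_twistFamilyItems` — the «single book»: C5 ⟸ seven prints (+ D–D) ∧
  27071 ∧ 27552 ∧ 27072 ∧ C1 (stmt-25939) ∧ C2 (stmt-26929), RED(13♯) from `coreRED13_of_notBottom_of_strongIsTop` (p621027).

NET: the C5 line's cone is {6 cite-only prints} ∪ {stmt-27071, stmt-27552, stmt-27072} ∪ {E-imc-9(13)}: every input at
`p ∈ {5, 7}` is a registered item of route `TwistFamilyManinDescent` (the two books of the lead's 11:27Z ORIENTATION note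
now differ only on the `p ≥ 11` reducible locus: MazurJ ∧ EdG ∧ EdK ∧ E-imc-9(13) here). HONEST STATUS: conditional
results (`--supports`, helper); K15a, K15b, 27552, E-imc-9 are OPEN, the six prints are cite-only; nothing here proves any
of them, C5, Manin's conjecture or BSD.

References: [GealyKlagsbrun2017] Thm. 1; [Stevens1989] §2; [EdixhovenManin1991] Thm. 3, §4; [KostersPannekoek2017] Thm. 1;
[CesnaviciusNeururerSaha2023] Thm. 1.2; [Mazur1978] Thm. 1; [Kato2004Asterisque] (8.1.3), Thm. 9.7; [SilvermanATAEC1994]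
IV Table 4.1; [SerreTate1968] §2 Cor. 3; [Delbourgo1998] §1.5.
-/

set_option autoImplicit false
-- the Theorems namespace of this sub repeats the summit name by design (D-0017 nested layout)
set_option linter.dupNamespace false

noncomputable section

open scoped Classical NumberField

namespace Summit.BirchSwinnertonDyer.BirchSwinnertonDyer.Theorems

open WeierstrassCurve IsDedekindDomain IsDedekindDomain.HeightOneSpectrum Rat.HeightOneSpectrum NumberField
  Literature.NumberTheory.EllipticCurves Literature.NumberTheory.EllipticCurves.ModularForms
  Literature.NumberTheory.EllipticCurves.Rank1Residual
  Literature.NumberTheory.DiophantineGeometry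
  Summit.BirchSwinnertonDyer.Rank1Residual
  Summit.BirchSwinnertonDyer.Rank1Residual.ManinAdditive
  Summit.BirchSwinnertonDyer.Rank1Residual.Additive

/-! ## §1 K15a ⟸ modularity ∧ Gealy–Klagsbrun ∧ E-imc-5(5) ∧ E-imc-5(7): the swap is a WEAKENING -/

/-- **K15a `TwistFamilyManinDescent.SupersingularStrongIsUnstarred` (stmt-BirchSwinnertonDyer-27072) BY NAME ⟸
modularity ∧ Gealy–Klagsbrun 2017 Thm. 1 ∧ E-imc-5 `OptimalUnstarredAcrossIsogeny` at `5` and at `7`** — so every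
statement the C5 line derived from law (U) it may derive from K15a, and socketing the line on K15a instead of
E-imc-5(5) ∧ E-imc-5(7) ∧ GK is a weakening of hypotheses. Proof: on K15a's rows `(5; 4)`, `(7; 3)` the conclusion
`ord_p Δ_min < 6` is immediate; on `(5; 8)`, `(7; 9)` the curve is additive (`p² ∣ N`, level = conductor by
modularity), potentially good (its `p*`-twist is not multiplicative), without `Iₙ*` fibre and NOT (G)-ordinary
(tame index `3 ∤ 4`, `4 ∤ 6`), so the width seat's kernel `padicValInt_le_four_of_acrossIsogeny_of_gealyKlagsbrun`
(υ, p626338) gives `ord_p Δ_min ≤ 4` — contradiction. Conditional result; closes nothing.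
[cite: GealyKlagsbrun2017, Thm. 1] [cite: Stevens1989, §2] [cite: SilvermanATAEC1994, IV Table 4.1] -/
theorem supersingularStrongIsUnstarred_of_acrossIsogeny_of_gealyKlagsbrun (hnf : exists_isNewformOf)
    (hGK : gealyKlagsbrun2017_neronScalar_of_additive_potSupersingular)
    (hE5 : OptimalUnstarredAcrossIsogeny 5) (hE7 : OptimalUnstarredAcrossIsogeny 7) :
    Summit.BirchSwinnertonDyer.BirchSwinnertonDyer.Theses.TwistFamilyManinDescent.SupersingularStrongIsUnstarred := by
  intro W _ _ N _ D p hp hrow hpN hred htw hD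
  haveI hpF : Fact p.Prime := ⟨hp⟩
  obtain rfl : N = W.conductorNorm ℤ := IsNewformOf.level_eq_conductorNorm_of_exists_isNewformOf hnf D.isNewformOf
  have h57 : p = 5 ∨ p = 7 := by
    rcases hrow with ⟨h, -⟩ | ⟨h, -⟩
    · exact Or.inl h
    · exact Or.inr h
  have hp5 : 5 ≤ p := by rcases h57 with rfl | rfl <;> norm_num
  have hp2 : p ≠ 2 := by omega
  have hadd : Addv W p := not_good_and_not_mult_of_sq_dvd_conductorNorm W hpN
  have hj : 0 ≤ padicValRat p W.j := padicValRat_j_nonneg_of_addv_of_twist_pStar_not_semistable W p hp2 hadd htw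
  -- the row: either unstarred (done) or `(5; 8)` / `(7; 9)`
  have hrow' : padicValInt p W.minimalDiscriminantInt < 6 ∨
      (p = 5 ∧ padicValInt p W.minimalDiscriminantInt = 8) ∨ (p = 7 ∧ padicValInt p W.minimalDiscriminantInt = 9) := by
    rcases hrow with ⟨rfl, h⟩ | ⟨rfl, h⟩ <;>
      simp only [Finset.mem_insert, Finset.mem_singleton] at h <;> omega
  rcases hrow' with h | hstar
  · exact h
  exfalso
  have hv : padicValInt p W.minimalDiscriminantInt = 8 ∨ padicValInt p W.minimalDiscriminantInt = 9 := by
    rcases hstar with ⟨-, h⟩ | ⟨-, h⟩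
    · exact Or.inl h
    · exact Or.inr h
  have h6 : padicValInt p W.minimalDiscriminantInt ≠ 6 := by omega
  have hI := forall_kodairaSymbolAt_ne_Istar_of_padicValRat_j_nonneg_of_ne_six W p hp5 hadd hj h6
  have hG : ¬ TypeGOrd W p :=
    not_typeGOrd_of_starred_nonGord_row W hadd (by
      rcases hstar with ⟨h5, h⟩ | ⟨h7, h⟩
      · exact Or.inl ⟨h5, h⟩
      · exact Or.inr (Or.inr ⟨h7, h⟩))
  have hE : OptimalUnstarredAcrossIsogeny p := by
    rcases h57 with rfl | rfl
    · exact hE5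
    · exact hE7
  have hle := padicValInt_le_four_of_acrossIsogeny_of_gealyKlagsbrun hGK hp5 hE W D hD hpN hred hI hG
  omega


/-! ## §2 RED(57♯) BY NAME from ČNS ∧ stmt-27071 ∧ stmt-27552 ∧ stmt-27072 -/

/-- **RED(57♯) (hypothesis `h57s` of `coreRED57_of_cns_cremona_of_coreRED57sharp`, p612504, VERBATIM) ⟸ ČNS ∧ K15b
(stmt-27071) ∧ `OrdinaryCornerManinResidual` (stmt-27552) ∧ K15a (stmt-27072).** Unstarred half: the lead's flip-twin
reduction (p622240) over the three Raynaud cells (p625709, by-name plumbing p628635) and CORNER(5; II) from K15a (part 1);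
starred half: part 1's `coreRED57starred_of_twistFamilyItems`. No law (U), no E-imc-5, no Gealy–Klagsbrun, no D–D.
Conditional result; closes nothing. [cite: CesnaviciusNeururerSaha2023, Thm. 1.2] [cite: EdixhovenManin1991, Thm. 3] -/
theorem coreRED57sharp_of_cns_of_twistFamilyItems
    (hCNS : cesnaviciusNeururerSaha_padicVal_maninConstant_le_modularDegree)
    (hSS : Summit.BirchSwinnertonDyer.BirchSwinnertonDyer.Theses.TwistFamilyManinDescent.SupersingularUnstarredStrongManinUnit)
    (hOrd : Summit.BirchSwinnertonDyer.BirchSwinnertonDyer.Theses.TwistFamilyManinDescent.OrdinaryCornerManinResidual)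
    (hSU : Summit.BirchSwinnertonDyer.BirchSwinnertonDyer.Theses.TwistFamilyManinDescent.SupersingularStrongIsUnstarred) :
    mazur_not_dvd_maninConstant_of_odd → abbesUllmo_not_dvd_maninConstant_of_not_dvd_level →
    cesnavicius_not_two_dvd_maninConstant_of_two_dvd_level → exists_isNewformOf →
    ∀ (W : WeierstrassCurve ℚ) [W.IsElliptic] [W.IsGloballyMinimal] [NeZero (W.conductorNorm ℤ)]
      (D : ModularParametrizationData W (W.conductorNorm ℤ)),
      IsLatticeOptimal D → ∀ (p : ℕ) (hp : p.Prime), (p = 5 ∨ p = 7) → p ^ 2 ∣ W.conductorNorm ℤ →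
      ¬ (∃ (W' : WeierstrassCurve ℚ) (q : ℕ), W'.IsElliptic ∧ W'.IsGloballyMinimal ∧ q.Prime ∧
          q ≠ 2 ∧ q ^ 2 ∣ W.conductorNorm ℤ ∧
          IsIsogenous W (W'.quadraticTwist (((-1 : ℤ) ^ (q / 2) * q : ℤ) : ℚ)) ∧
          ¬ q ^ 2 ∣ W'.conductorNorm ℤ) →
      ¬ (∃ (W' : WeierstrassCurve ℚ) (d : ℤ), W'.IsElliptic ∧ W'.IsGloballyMinimal ∧
          (d = -1 ∨ d = 2 ∨ d = -2) ∧ 2 ^ 2 ∣ W.conductorNorm ℤ ∧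
          IsIsogenous W (W'.quadraticTwist (d : ℚ)) ∧ ¬ 2 ^ 2 ∣ W'.conductorNorm ℤ) →
      ¬ W.HasIrreducibleModPGaloisRep p →
      500000 < W.conductorNorm ℤ →
      p ∣ D.modularDegree →
      (∀ n : ℕ, W.kodairaSymbolAt ((Rat.HeightOneSpectrum.primesEquiv (R := ℤ)).symm ⟨p, hp⟩) ≠
        .Istar n) →
      ¬ (p : ℤ) ∣ D.maninConstant :=
  coreRED57sharp_of_unstarred_of_starred
    (coreRED57unstarred_of_cns_of_offTypeIIAtFive_of_typeIIAtFiveCorner hCNS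
      (coreRED57unstarredOffII5_of_cells (red57ss_of_ssUnstarredStrong hSS) (red7ordIV_of_ordinaryCorner hOrd)
        (red57corner_of_ordinaryCorner hOrd))
      (cornerTypeIIAtFive_of_strongIsUnstarred hSU))
    (coreRED57starred_of_twistFamilyItems hSS hOrd hSU)

/-! ## §3 C5 BY NAME from SIX prints ∧ stmt-27071 ∧ stmt-27552 ∧ stmt-27072 ∧ E-imc-9(13) -/

/-- **Crux C5 `ManinLocalTwoThree.ManinPrimeToAdditiveFiveLe` BY NAME ⟸ SIX cite-only printed facts (Kato F″, ČNS Thm. 1.2,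
Cremona's table `N ≤ 5·10⁵`, Edixhoven 1991 Thm. 3 Kodaira half and ordinarity half, Mazur 1978 Thm. 1) ∧ K15b
`SupersingularUnstarredStrongManinUnit` (stmt-27071) ∧ `OrdinaryCornerManinResidual` (stmt-27552) ∧ K15a
`SupersingularStrongIsUnstarred` (stmt-27072) ∧ E-imc-9 `OrdinaryRamifiedTwistLaw 13`.** The lead's
`maninPrimeToAdditiveFiveLe_of_sevenPrints_of_twistFamilyItems_of_imcLaws` with {Gealy–Klagsbrun, E-imc-5(5), E-imc-5(7)}
replaced by the single, weaker (§1) TFMD item K15a: irreducible locus `coreKP_of_kato` (modularity ∧ F″), reducible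
residual `reducibleTwistMinimal_of_edixhoven_cns_of_cores` (p608852) over RED(57♯) (§2) and RED(13♯)
(`red13sharp_of_edixhovenKodairaFact_of_ordinaryRamifiedTwistLaw`, p626766). Conditional result (`--supports`, helper): the
six prints are cite-only, 27071 / 27552 / 27072 / E-imc-9(13) are OPEN; C5 is NOT proved; BSD is not proved.
[cite: Kato2004Asterisque, (8.1.3) and Thm. 9.7] [cite: CesnaviciusNeururerSaha2023, Thm. 1.2] [cite: EdixhovenManin1991, Thm. 3]
[cite: Mazur1978, Thm. 1] [cite: KostersPannekoek2017, Thm. 1] -/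
theorem maninPrimeToAdditiveFiveLe_of_sixPrints_of_twistFamilyItems_of_ordinaryTwistLaw
    (hK57 : kato_neron_isIntegral_twistedSymbolSum_of_additive_five_le)
    (hCNS : cesnaviciusNeururerSaha_padicVal_maninConstant_le_modularDegree)
    (h500k : cremona_abs_maninConstant_eq_one_of_level_le_500000)
    (hEdK : edixhoven_not_dvd_maninConstant_of_kodairaSymbol_ne)
    (hEdG : edixhoven_not_dvd_maninConstant_of_not_potentiallyGoodOrdinary)
    (hJ : mazur_j_mem_of_not_hasIrreducibleModPGaloisRep_of_eleven_le)
    (hK15b : Summit.BirchSwinnertonDyer.BirchSwinnertonDyer.Theses.TwistFamilyManinDescent.SupersingularUnstarredStrongManinUnit)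
    (hOrd : Summit.BirchSwinnertonDyer.BirchSwinnertonDyer.Theses.TwistFamilyManinDescent.OrdinaryCornerManinResidual)
    (hK15a : Summit.BirchSwinnertonDyer.BirchSwinnertonDyer.Theses.TwistFamilyManinDescent.SupersingularStrongIsUnstarred)
    (hO13 : OrdinaryRamifiedTwistLaw 13) :
    Summit.BirchSwinnertonDyer.BirchSwinnertonDyer.Theses.ManinLocalTwoThree.ManinPrimeToAdditiveFiveLe := by
  have h57 := coreRED57_of_cns_cremona_of_coreRED57sharp hCNS h500k
    (coreRED57sharp_of_cns_of_twistFamilyItems hCNS hK15b hOrd hK15a)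
  have h11 := coreRED11_of_mazurJ_of_coreRED13 hJ
    (coreRED13_of_cremona_of_coreRED13sharp h500k
      (red13sharp_of_edixhovenKodairaFact_of_ordinaryRamifiedTwistLaw hEdK hO13))
  intro hM hAU hC hnf
  exact maninLocalTwoThree_maninPrimeToAdditiveFiveLe_of_kato57_of_cores hK57 (coreKP_of_kato hnf hK57)
    (reducibleTwistMinimal_of_edixhoven_cns_of_cores hEdK hEdG hCNS h57 h11) hM hAU hC hnf


/-! ## §4 C5 BY NAME from SEVEN prints and FIVE items of route `TwistFamilyManinDescent` only — ONE book -/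

/-- **Crux C5 BY NAME as a corollary of route `TwistFamilyManinDescent`'s registered items and cite-only prints ONLY**:
⟸ {Kato F″, ČNS Thm. 1.2, Cremona `N ≤ 5·10⁵`, Edixhoven Thm. 3 (Kodaira half, ordinarity half), Mazur 1978 Thm. 1,
Dokchitser–Dokchitser 2015 Thm. 5.1 (1)} ∧ K15b (stmt-27071) ∧ `OrdinaryCornerManinResidual` (stmt-27552) ∧ K15a
(stmt-27072) ∧ C1 `EisensteinOrdinaryTwistLatticeNotBottom` (stmt-25939) ∧ C2 `EisensteinOrdinaryStrongIsTop` (stmt-26929)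
— §3 with the RED(13♯) input taken from pub/bsd-wall's `coreRED13_of_notBottom_of_strongIsTop` (p621027, seat
bsd-line-ttd-p1) instead of E-imc-9(13). This is the «single book» the lead's ORIENTATION note (2026-08-28T11:27Z) asks
the planners to choose: the C5 line's composition with EVERY open input a TFMD item. Conditional result (`--supports`,
helper); nothing here proves C5, any TFMD item, Manin's conjecture or BSD.
[cite: DokchitserDokchitser2015LocalInvariants, Thm. 5.1 (1)] [cite: EdixhovenManin1991, Thm. 3] [cite: Mazur1978, Thm. 1] -/
theorem maninPrimeToAdditiveFiveLe_of_sevenPrints_of_twistFamilyItems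
    (hK57 : kato_neron_isIntegral_twistedSymbolSum_of_additive_five_le)
    (hCNS : cesnaviciusNeururerSaha_padicVal_maninConstant_le_modularDegree)
    (h500k : cremona_abs_maninConstant_eq_one_of_level_le_500000)
    (hEdK : edixhoven_not_dvd_maninConstant_of_kodairaSymbol_ne)
    (hEdG : edixhoven_not_dvd_maninConstant_of_not_potentiallyGoodOrdinary)
    (hJ : mazur_j_mem_of_not_hasIrreducibleModPGaloisRep_of_eleven_le)
    (hDD : dokchitser_padicValInt_minimalDiscriminantInt_eq_of_isogeny_of_potentiallyGoodOrdinary)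
    (hK15b : Summit.BirchSwinnertonDyer.BirchSwinnertonDyer.Theses.TwistFamilyManinDescent.SupersingularUnstarredStrongManinUnit)
    (hOrd : Summit.BirchSwinnertonDyer.BirchSwinnertonDyer.Theses.TwistFamilyManinDescent.OrdinaryCornerManinResidual)
    (hK15a : Summit.BirchSwinnertonDyer.BirchSwinnertonDyer.Theses.TwistFamilyManinDescent.SupersingularStrongIsUnstarred)
    (hC1 : Summit.BirchSwinnertonDyer.BirchSwinnertonDyer.Theses.TwistFamilyManinDescent.EisensteinOrdinaryTwistLatticeNotBottom)
    (hC2 : Summit.BirchSwinnertonDyer.BirchSwinnertonDyer.Theses.TwistFamilyManinDescent.EisensteinOrdinaryStrongIsTop) :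
    Summit.BirchSwinnertonDyer.BirchSwinnertonDyer.Theses.ManinLocalTwoThree.ManinPrimeToAdditiveFiveLe := by
  have h57 := coreRED57_of_cns_cremona_of_coreRED57sharp hCNS h500k
    (coreRED57sharp_of_cns_of_twistFamilyItems hCNS hK15b hOrd hK15a)
  have h11 := coreRED11_of_mazurJ_of_coreRED13 hJ (coreRED13_of_notBottom_of_strongIsTop hC1 hC2 hEdK hDD)
  intro hM hAU hC hnf
  exact maninLocalTwoThree_maninPrimeToAdditiveFiveLe_of_kato57_of_cores hK57 (coreKP_of_kato hnf hK57)
    (reducibleTwistMinimal_of_edixhoven_cns_of_cores hEdK hEdG hCNS h57 h11) hM hAU hC hnf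

end Summit.BirchSwinnertonDyer.BirchSwinnertonDyer.Theorems

end
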